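import Literature.NumberTheory.GaloisRepresentations.AdequacyDegreeP
import HarnessLib

/-!
# `H¹(H, ad/Z) = 0` for a cyclic Sylow `p`-subgroup of order `p` acting freely (GHT 2017, Lemmas 6.2–6.3)

Topic `NumberTheory/GaloisRepresentations`; a sibling of `AdequacyDegreeP.lean` (the named fact
`ght2017_adequate_or_index_p_or_psl29` = Guralnick–Herzig–Tiep 2017, Thm 1.7, with the imprimitive
branch Prop. 6.6 proved in namespace `MonomialAdequacy`) and of
`PrimeDegreePrimitiveQuasisimple.lean` (the primitive branch reduced, classification-free, to GHT
Theorem 2.2's input: `ght2017_adequate_or_index_p_or_psl29_of_socle_odd`).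

In the printed proof of GHT Theorem 6.15 (arXiv p. 24), clause (ii) of adequacy —
`H¹(G, ad/Z) = 0`, `ad/Z = End(V)/k` — is obtained in every case with a Sylow `p`-subgroup of
order `p` (the imprimitive case, Prop. 6.6, and all the cross-characteristic cases for `p > 3`:
`A_{p+1}`, `PSp_{2n}(q)`, `SL_n(q)`, `SU_n(q)`, sporadic) from two lemmas:

> Lemma 6.2. Let `G` be a finite group with a Sylow `p`-subgroup `P` of order `p` and let
> `V ∈ IBr_p(G)` be such that `p ∣ dim V`. Then `V` is projective.  [Green correspondence]
>
> Lemma 6.3. Let `G` be a finite group with a cyclic Sylow `p`-subgroup `P` and `p = char(k)`.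
> Suppose that `G = O^p(G)`. Then `H¹(G, k) = H²(G, k) = 0`.  [Schur multipliers]

("`V` lifts to a complex module of `p`-defect `0`, whence `V` is projective and so
`Ext¹_G(V, V) = 0`"; with `H²(G, k) = 0` the sequence `0 → k → End V → ad/Z → 0` gives (ii).)
This file PROVES the conclusion by the elementary mechanism already used for Prop. 6.6 in
`AdequacyDegreeP.lean` (`MonomialAdequacy.exists_apply_eq_sub_of_normalizer`), with the freeness of
`V` over `k⟨y⟩` (which is what projectivity means for `|P| = p`) as an explicit hypothesis:

* `Subgroup.cocycles₁_le_coboundaries₁_of_cyclicBasis` — `H ≤ GL_p(k)` finite, `char k = p`,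
  `p² ∤ |H|`, `y ∈ H` of order `p` permuting a basis cyclically (`kᵖ` free over `k⟨y⟩`), and no
  normal `p`-complement ⟹ every `1`-cocycle `H → ad/Z` is a coboundary.  (On `⟨y⟩` the norm of
  a lift of `f(y)` is a scalar `λ`; a `z ∈ N_H(⟨y⟩)` with `z y z⁻¹ = y^r`, `r ≢ 1` — Burnside's
  transfer theorem — forces `r λ = λ`, `λ = 0`, and then `f(y)` is a coboundary because
  `H¹(C_p, End of a free module) = 0` by a dimension count; restriction to `N_H(⟨y⟩)` (index
  `≡ 1 mod p`) and to `⟨y⟩` inside it (index prime to `p`) reflects coboundaries.)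
* `exists_cyclicBasis_of_linearIndependent` — a cyclic vector for `y` (e.g. `y` regular
  unipotent) gives the cyclic basis.
* `index_ne_of_simple_le`, `Subgroup.cocycles₁_le_coboundaries₁_of_cyclicBasis_of_simple_le` — a
  simple non-abelian subgroup of order divisible by `p` excludes a normal `p`-complement, so in the
  almost quasisimple (primitive) case only `p² ∤ |H|` and the freeness remain as hypotheses.

No classification of finite simple groups, no modular representation theory beyond linear algebra.

## References

* [GuralnickHerzigTiep2017] R. M. Guralnick, F. Herzig, P. H. Tiep, *Adequate subgroups and
  indecomposable modules*, J. Eur. Math. Soc. 19 (2017) 1231–1291 = arXiv:1405.0043, Lemmas 6.2,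
  6.3 (arXiv p. 19) and the proof of Theorem 6.15 (p. 24).
* [Thorne2017TwoAdic] J. Thorne, Math. Z. 285 (2017), Def. 2.20 (the notion of adequacy).
-/

open scoped MatrixGroups Matrix

namespace Literature.NumberTheory.GaloisRepresentations

universe u

section CyclicSylowFree

variable {p : ℕ} [Fact p.Prime] {k : Type u} [Field k] [CharP k p]

/-- A Sylow `p`-subgroup of a finite group `H` with `p ∣ |H|`, `p² ∤ |H|` containing an element `y`
of order `p` is `⟨y⟩`, of order `p`. [folklore] -/
theorem sylow_eq_zpowers_of_not_sq_dvd {H : Type*} [Group H] [Finite H] (y : H)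
    (hy : orderOf y = p) (hp2 : ¬p ^ 2 ∣ Nat.card H) :
    ∃ P : Sylow p H, Nat.card P = p ∧ (P : Subgroup H) = Subgroup.zpowers y := by
  have hp : p.Prime := Fact.out
  have hPy : IsPGroup p (Subgroup.zpowers y) := by
    apply IsPGroup.of_card (n := 1)
    rw [Nat.card_zpowers, hy, pow_one]
  obtain ⟨P, hle⟩ := hPy.exists_le_sylow
  have hcard : Nat.card P = p := by
    rw [Sylow.card_eq_multiplicity]
    have hdvd : p ∣ Nat.card H := by
      rw [← hy]; exact orderOf_dvd_natCard y
    have h1 : 0 < (Nat.card H).factorization p :=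
      hp.factorization_pos_of_dvd Nat.card_pos.ne' hdvd
    have h2 : (Nat.card H).factorization p < 2 := by
      by_contra hge
      exact hp2 ((pow_dvd_pow p (not_lt.1 hge)).trans (Nat.ordProj_dvd _ _))
    have h3 : (Nat.card H).factorization p = 1 := by omega
    rw [h3, pow_one]
  refine ⟨P, hcard, ?_⟩
  symm
  apply Subgroup.eq_of_le_of_card_ge hle
  rw [hcard, Nat.card_zpowers, hy]

/-- **Burnside, in the form needed.**  If the Sylow `p`-subgroup `P = ⟨y⟩` of `H` has order `p` and
`H` has no normal subgroup of `p'`-order and index `p` (no normal `p`-complement), some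
`z ∈ N_H(P)` acts non-trivially: `z y z⁻¹ = y ^ r`, `r ≢ 1 (mod p)` (and `z⁻¹ y z = y ^ s`,
`p ∤ s`). [folklore] -/
theorem exists_conj_eq_pow_of_no_normal_complement {H : Type*} [Group H] [Finite H]
    (P : Sylow p H) (y : H) (hP : (P : Subgroup H) = Subgroup.zpowers y) (hy : orderOf y = p)
    (hnc : ∀ K : Subgroup H, K.Normal → ¬p ∣ Nat.card K → K.index ≠ p) :
    ∃ z : H, ∃ r s : ℕ, z * y * z⁻¹ = y ^ r ∧ z⁻¹ * y * z = y ^ s ∧ ¬r ≡ 1 [MOD p] ∧ ¬p ∣ s := by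
  have hp : p.Prime := Fact.out
  have hcardP : Nat.card P = p := by rw [hP, Nat.card_zpowers, hy]
  have hPset : (P : Set H) = (Subgroup.zpowers y : Set H) := by rw [← P.coe_coe, hP]
  -- Burnside's normal `p`-complement theorem
  have hNC : ¬Subgroup.normalizer (P : Set H) ≤ Subgroup.centralizer (P : Set H) := by
    intro hle
    have hcomp := MonoidHom.ker_transferSylow_isComplement' P hle
    refine hnc (MonoidHom.transferSylow P hle).ker inferInstance
      (MonoidHom.not_dvd_card_ker_transferSylow P hle) ?_
    rw [hcomp.symm.index_eq_card]
    exact hcardP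
  obtain ⟨z, hzN, hzC⟩ := Set.not_subset.1 hNC
  refine ⟨z, ?_⟩
  have hzN1 : z ∈ Subgroup.normalizer (Subgroup.zpowers y : Set H) := by rwa [hPset] at hzN
  have hzN2 : z⁻¹ ∈ Subgroup.normalizer (Subgroup.zpowers y : Set H) := Subgroup.inv_mem _ hzN1
  have hmem1 : z * y * z⁻¹ ∈ Subgroup.zpowers y :=
    ((Subgroup.mem_normalizer_iff).1 hzN1 y).1 (Subgroup.mem_zpowers y)
  have hmem2 : z⁻¹ * y * z ∈ Subgroup.zpowers y := by
    have h := ((Subgroup.mem_normalizer_iff).1 hzN2 y).1 (Subgroup.mem_zpowers y)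
    rwa [inv_inv] at h
  rw [← mem_powers_iff_mem_zpowers, Submonoid.mem_powers_iff] at hmem1 hmem2
  obtain ⟨r, hr⟩ := hmem1
  obtain ⟨s, hs⟩ := hmem2
  refine ⟨r, s, hr.symm, hs.symm, ?_, ?_⟩
  · intro hr1
    apply hzC
    rw [SetLike.mem_coe, Subgroup.mem_centralizer_iff]
    intro g hg
    have hg' : g ∈ Subgroup.zpowers y := by
      rw [← SetLike.mem_coe, ← hPset]; exact hg
    obtain ⟨m, rfl⟩ := (Subgroup.mem_zpowers_iff).1 hg'
    have hyz : y * z = z * y := by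
      have h1 : y ^ r = y ^ 1 := by rw [pow_eq_pow_iff_modEq, hy]; exact hr1
      rw [pow_one] at h1
      rw [h1] at hr
      have h2 := congrArg (· * z) hr
      simp [mul_assoc] at h2
      exact h2
    exact (Commute.zpow_left hyz m).eq
  · intro hps
    have h1 : y ^ s = 1 := by
      rw [← orderOf_dvd_iff_pow_eq_one, hy]; exact hps
    rw [h1] at hs
    have h2 : y = 1 := by
      have h3 := congrArg (fun w => z * w * z⁻¹) hs
      simp [mul_assoc] at h3
      exact h3.symm
    rw [h2, orderOf_one] at hy
    exact hp.one_lt.ne hy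


omit [CharP k p] in
/-- **A cyclic vector gives a cyclic basis.**  If `y ∈ GL_p(k)` has order `p` and `v` is a cyclic
vector (`v, y v, …, y^{p-1} v` linearly independent — e.g. `y` a regular unipotent, one Jordan
block), then `e_w := y^w v` (`w ∈ ℤ/p`) is a basis with `y e_w = e_{w+1}`: `kᵖ` is free of rank one
over `k⟨y⟩`. [folklore] -/
theorem exists_cyclicBasis_of_linearIndependent (y : GL (Fin p) k) (hy : orderOf y = p)
    (v : Fin p → k)
    (hli : LinearIndependent k fun i : Fin p =>
      ((y ^ (i : ℕ) : GL (Fin p) k) : Matrix (Fin p) (Fin p) k) *ᵥ v) :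
    ∃ e : Module.Basis (ZMod p) k (Fin p → k),
      ∀ w, ((y : GL (Fin p) k) : Matrix (Fin p) (Fin p) k) *ᵥ e w = e (w + 1) := by
  classical
  have hp : p.Prime := Fact.out
  let ι : ZMod p → Fin p := fun w => ⟨w.val, w.val_lt⟩
  have hι : Function.Injective ι := fun a b h => ZMod.val_injective p (congrArg Fin.val h)
  let E : ZMod p → (Fin p → k) := fun w =>
    ((y ^ w.val : GL (Fin p) k) : Matrix (Fin p) (Fin p) k) *ᵥ v
  have hE : E = (fun i : Fin p =>
      ((y ^ (i : ℕ) : GL (Fin p) k) : Matrix (Fin p) (Fin p) k) *ᵥ v) ∘ ι := by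
    funext w; rfl
  have hEli : LinearIndependent k E := by rw [hE]; exact hli.comp ι hι
  let e : Module.Basis (ZMod p) k (Fin p → k) :=
    basisOfLinearIndependentOfCardEqFinrank hEli (by
      rw [ZMod.card, Module.finrank_fintype_fun_eq_card, Fintype.card_fin])
  have he : ∀ w, e w = E w := fun w => by
    simp only [e, coe_basisOfLinearIndependentOfCardEqFinrank]
  refine ⟨e, fun w => ?_⟩
  have hmod : w.val + 1 ≡ (w + 1).val [MOD p] := by
    have h := MonomialAdequacy.zmod_val_add_natCast_modEq w 1
    rwa [Nat.cast_one] at h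
  rw [he, he]
  simp only [E]
  rw [Matrix.mulVec_mulVec, ← Units.val_mul, ← pow_succ',
    MonomialAdequacy.pow_eq_pow_of_modEq_of_orderOf_eq hy hmod]

/-- **Clause (ii) of adequacy for a cyclic Sylow `p`-subgroup of order `p` acting freely.**  Let
`H ≤ GL_p(k)` be finite, `char k = p`, with `p² ∤ |H|`, and let `y ∈ H` of order `p` permute a
basis of `kᵖ` cyclically (`y e_v = e_{v+1}`, `v ∈ ℤ/p`: `kᵖ` is free of rank one over `k⟨y⟩`,
i.e. `y` is a regular unipotent — one Jordan block).  If `H` has no normal subgroup of `p'`-order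
and index `p` (no normal `p`-complement), then `H¹(H, ad/Z) = 0`: every `1`-cocycle
`H → M_p(k)/k` is a coboundary.  (Restriction to `N_H(⟨y⟩)`, of index `≡ 1 (mod p)`, and to
`⟨y⟩`, of index prime to `p` in it, reflects coboundaries; on `⟨y⟩` a cocycle is a coboundary by
`MonomialAdequacy.exists_apply_eq_sub_of_normalizer`, using a `z ∈ N_H(⟨y⟩)` acting
non-trivially, which exists by Burnside's transfer theorem.)  This is the mechanism behind GHT's
use of Lemma 6.2 (`V` projective, so `Ext¹_G(V, V) = 0`) and Lemma 6.3 (`H²(G, k) = 0` for cyclic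
Sylow) in all the cases of Theorem 6.15 with `|P| = p` — the imprimitive case Prop. 6.6 and the
cross-characteristic cases of Props. 6.11–6.13, Lemmas 6.9, 6.14 ("`V` lifts to a complex module of
`p`-defect `0`, whence `V` is projective") — with the freeness of `V` over `k⟨y⟩` as an explicit
hypothesis instead of Lemma 6.2's Green-correspondence argument.
[cite: GuralnickHerzigTiep2017, Lemmas 6.2–6.3 and proof of Theorem 6.15 (p. 24)] -/
theorem Subgroup.cocycles₁_le_coboundaries₁_of_cyclicBasis (H : Subgroup (GL (Fin p) k)) [Finite H]
    (y : H) (hy : orderOf y = p) (hp2 : ¬p ^ 2 ∣ Nat.card H)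
    (e : Module.Basis (ZMod p) k (Fin p → k))
    (he : ∀ v, ((y : GL (Fin p) k) : Matrix (Fin p) (Fin p) k) *ᵥ e v = e (v + 1))
    (hnc : ∀ K : Subgroup H, K.Normal → ¬p ∣ Nat.card K → K.index ≠ p) :
    groupCohomology.cocycles₁ (Rep.of (Subgroup.adModScalarRep H)) ≤
      groupCohomology.coboundaries₁ (Rep.of (Subgroup.adModScalarRep H)) := by
  classical
  rw [cocycles₁_le_coboundaries₁_iff_forall]
  intro f hf
  change ∀ g h : H, f (g * h) = Subgroup.adModScalarRep H g (f h) + f g at hf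
  change ∃ m, ∀ g : H, f g = Subgroup.adModScalarRep H g m - m
  obtain ⟨P, -, hPy⟩ := sylow_eq_zpowers_of_not_sq_dvd y hy hp2
  obtain ⟨z, r, s, hr, hs, hr1, hs0⟩ := exists_conj_eq_pow_of_no_normal_complement P y hPy hy hnc
  have hyG : orderOf (y : GL (Fin p) k) = p := by rw [Subgroup.orderOf_coe, hy]
  have hr1k : (r : k) ≠ 1 := fun h =>
    hr1 ((CharP.natCast_eq_natCast k p).1 (by rw [h, Nat.cast_one]))
  -- on the generator, then on `P = ⟨y⟩`
  obtain ⟨m₁, hm₁⟩ :=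
    MonomialAdequacy.exists_apply_eq_sub_of_normalizer y z hyG r s hr hs hr1k hs0 e he f hf
  have hP : ∀ x : H, x ∈ (P : Subgroup H) → f x = Subgroup.adModScalarRep H x m₁ - m₁ := by
    intro x hx
    rw [hPy] at hx
    obtain ⟨n, rfl⟩ := (Submonoid.mem_powers_iff _ _).1 (mem_powers_iff_mem_zpowers.2 hx)
    exact MonomialAdequacy.cocycle_apply_pow_of_eq_sub _ f hf y m₁ hm₁ n
  -- on the normaliser `N` of `P`
  have hPN : (P : Subgroup H) ≤ Subgroup.normalizer (P : Set H) := Subgroup.le_normalizer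
  have hidx1 : ((((P : Subgroup H).subgroupOf (Subgroup.normalizer (P : Set H))).index : ℕ) : k) ≠
      0 := by
    intro h0
    rw [CharP.cast_eq_zero_iff k p] at h0
    exact P.not_dvd_index (h0.trans (Subgroup.relIndex_dvd_index_of_le hPN))
  obtain ⟨m₂, hm₂⟩ : ∃ m, ∀ x : Subgroup.normalizer (P : Set H),
      f x = Subgroup.adModScalarRep H x m - m :=
    MonomialAdequacy.exists_eq_sub_of_subgroup
      ((Subgroup.adModScalarRep H).comp (Subgroup.normalizer (P : Set H)).subtype)
      ((P : Subgroup H).subgroupOf (Subgroup.normalizer (P : Set H))) hidx1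
      (fun x : Subgroup.normalizer (P : Set H) => f x) (fun g h => hf g h)
      ⟨m₁, fun x hx => hP x ((Subgroup.mem_subgroupOf).1 hx)⟩
  -- on `H`
  have hidx2 : (((Subgroup.normalizer (P : Set H)).index : ℕ) : k) ≠ 0 := by
    have h1 : (Subgroup.normalizer (P : Set H)).index = Nat.card (Sylow p H) :=
      (Sylow.card_eq_index_normalizer P).symm
    have h2 : Nat.card (Sylow p H) ≡ 1 [MOD p] := card_sylow_modEq_one p H
    rw [h1, (CharP.natCast_eq_natCast k p).2 h2, Nat.cast_one]
    exact one_ne_zero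
  exact MonomialAdequacy.exists_eq_sub_of_subgroup _ (Subgroup.normalizer (P : Set H)) hidx2 f hf
    ⟨m₂, fun x hx => hm₂ ⟨x, hx⟩⟩

/-- **A normal `p`-complement is incompatible with a simple non-abelian subgroup of order
divisible by `p`.**  If `L ≤ H` is simple, non-commutative, with `p ∣ |L|`, then `H` has no normal
subgroup `K` of `p'`-order and index `p`: `K ∩ L ⊴ L` is `L` (but `p ∤ |K|`) or `1` (but then
`L ↪ H/K`, cyclic of order `p`). [folklore] -/
theorem index_ne_of_simple_le {H : Type*} [Group H] [Finite H] {L : Subgroup H}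
    (hsimple : IsSimpleGroup L) (hcomm : ¬∀ a b : L, a * b = b * a) (hdiv : p ∣ Nat.card L)
    (K : Subgroup H) [hKn : K.Normal] (hK : ¬p ∣ Nat.card K) : K.index ≠ p := by
  classical
  intro hidx
  have hp : p.Prime := Fact.out
  haveI := hsimple
  let M : Subgroup L := (K ⊓ L).subgroupOf L
  haveI hMn : M.Normal := ⟨fun x hx y => by
    simp only [M, Subgroup.mem_subgroupOf, Subgroup.mem_inf, Subgroup.coe_mul,
      Subgroup.coe_inv] at hx ⊢
    exact ⟨hKn.conj_mem _ hx.1 _, L.mul_mem (L.mul_mem y.2 hx.2) (L.inv_mem y.2)⟩⟩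
  rcases IsSimpleGroup.eq_bot_or_eq_top_of_normal M hMn with h0 | h1
  · -- `K ∩ L = 1`: `L` embeds in the cyclic group `H/K` of order `p`
    let π : L →* H ⧸ K := (QuotientGroup.mk' K).comp L.subtype
    have hinj : Function.Injective π := by
      rw [← MonoidHom.ker_eq_bot_iff, Subgroup.eq_bot_iff_forall]
      intro x hx
      rw [MonoidHom.mem_ker, MonoidHom.comp_apply, ← MonoidHom.mem_ker, QuotientGroup.ker_mk',
        Subgroup.coe_subtype] at hx
      have hxM : x ∈ M := by
        rw [Subgroup.mem_subgroupOf]; exact Subgroup.mem_inf.2 ⟨hx, x.2⟩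
      rwa [h0, Subgroup.mem_bot] at hxM
    have hcardQ : Nat.card (H ⧸ K) = p := by rw [← Subgroup.index_eq_card, hidx]
    haveI : Fact p.Prime := ⟨hp⟩
    haveI : IsCyclic (H ⧸ K) := isCyclic_of_prime_card hcardQ
    letI := IsCyclic.commGroup (α := H ⧸ K)
    apply hcomm
    intro a b
    apply hinj
    rw [map_mul, map_mul, mul_comm]
  · -- `K ∩ L = L`: `p ∣ |L| ∣ |K|`
    have hLK : L ≤ K := fun x hx => by
      have hxM : (⟨x, hx⟩ : L) ∈ M := h1 ▸ Subgroup.mem_top _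
      rw [Subgroup.mem_subgroupOf] at hxM
      exact (Subgroup.mem_inf.1 hxM).1
    exact hK (hdiv.trans (Subgroup.card_dvd_of_le hLK))

/-- **Clause (ii) for the almost quasisimple case with `|P| = p` and a free `p`-element.**  If the
finite `H ≤ GL_p(k)` (`char k = p`, `p² ∤ |H|`) contains a simple non-commutative subgroup `L` of
order divisible by `p` and an element `y` of order `p` permuting a basis cyclically, then
`H¹(H, ad/Z) = 0`.  (Burnside's complement would meet `L` in `1` or `L`: `index_ne_of_simple_le`.)
In the residual situation of GHT Theorem 1.7 (`PrimeDegreePrimitiveQuasisimple.lean`: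
`ght2017_adequate_or_index_p_or_psl29_of_socle_odd`, where `L` is the simple layer, irreducible so
non-commutative, with `p ∣ |L|`) this settles clause (ii) whenever `p² ∤ |τ(G)|` and a
`p`-element is a regular unipotent — as in all the cross-characteristic cases of GHT's proof for
`p > 3` ("`V` lifts to a complex module of `p`-defect `0`, whence `V` is projective and so
`Ext¹_G(V, V) = 0`"; "`Mult(S)` is a `p'`-group … implies that `H²(G, k) = 0`").
[cite: GuralnickHerzigTiep2017, proof of Theorem 6.15 (p. 24), Lemmas 6.2–6.3] -/
theorem Subgroup.cocycles₁_le_coboundaries₁_of_cyclicBasis_of_simple_le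
    (H : Subgroup (GL (Fin p) k)) [Finite H] (y : H) (hy : orderOf y = p)
    (hp2 : ¬p ^ 2 ∣ Nat.card H) (e : Module.Basis (ZMod p) k (Fin p → k))
    (he : ∀ v, ((y : GL (Fin p) k) : Matrix (Fin p) (Fin p) k) *ᵥ e v = e (v + 1))
    {L : Subgroup H} (hsimple : IsSimpleGroup L) (hcomm : ¬∀ a b : L, a * b = b * a)
    (hdiv : p ∣ Nat.card L) :
    groupCohomology.cocycles₁ (Rep.of (Subgroup.adModScalarRep H)) ≤
      groupCohomology.coboundaries₁ (Rep.of (Subgroup.adModScalarRep H)) :=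
  Subgroup.cocycles₁_le_coboundaries₁_of_cyclicBasis H y hy hp2 e he
    fun K hKn hK => @index_ne_of_simple_le p _ H _ _ L hsimple hcomm hdiv K hKn hK

end CyclicSylowFree

end Literature.NumberTheory.GaloisRepresentations
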